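import Mathlib.Algebra.MvPolynomial.PDeriv
import Mathlib.RingTheory.MvPolynomial.Homogeneous
import Mathlib.RingTheory.MvPolynomial.EulerIdentity
import Mathlib.LinearAlgebra.QuadraticForm.Signature
import Mathlib.LinearAlgebra.Matrix.BilinearForm
import Mathlib.Data.Nat.Factorial.Basic
import Literature.LinearAlgebra.QuadraticForm.LorentzianReverseSchwarz
import HarnessLib

/-!
# Lorentzian polynomials (Brändén–Huh 2020, §2): M-convex sets, normalized coefficients, the iterated
# partial derivatives `∂^α`, the spaces `L^d_n` (Def. 2.6), the full-support criterion of Thm. 2.25 and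
# the Alexandrov–Fenchel-type inequalities `c_α² ≥ c_{α+e_i-e_j} c_{α-e_i+e_j}` (Prop. 4.4)

Layer `Literature/Combinatorics/LorentzianPolynomials`, namespace `Literature.Combinatorics.LorentzianPolynomials`;
lane `lit-hodgefound` (Track 2 foundations library), seat p16, generation 27 (row g27-#1). The sibling folder
`Literature/Combinatorics/StablePolynomials` (Borcea–Brändén, Brändén 2007; its `Basic.lean` notes: "The Lorentzian
vocabulary of Brändén–Huh is not introduced") is not imported; the signature vocabulary is Mathlib's
`QuadraticForm.sigPos` (Sylvester), read "at most one positive eigenvalue" = `sigPos ≤ 1` exactly as the lane's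
`LinearAlgebra/QuadraticForm/LorentzianReverseSchwarz` (Shenfeld–van Handel Lemma 2.9 (3)) and
`LinearAlgebra/Matrix/MixedDiscriminantLorentzianSignature` do; the backwards Schwarz inequality
`mul_le_sq_of_sigPos_le_one` of the former is used BY NAME in §6.

## Source (verbatim) — P. Brändén, J. Huh, *Lorentzian polynomials*, Ann. of Math. 192 (2020) = arXiv:1902.03719
## [BrandenHuh2019] (held `paper:arxiv-1902.03719`, arXiv numbering)

* §2.1 (p. 8): "`H^d_n` […] degree `d` homogeneous polynomials in `ℝ[w_1, …, w_n]` […] `P^d_n ⊆ H^d_n` […] all of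
  whose coefficients are positive. The *Hessian* of `f` […] `𝓗_f(w) = (∂_i ∂_j f)_{i,j=1}^n` […]
  `∂^α = ∂_1^{α_1} ⋯ ∂_n^{α_n}` […] `Δ^d_n = {α ∈ ℕ^n | |α|_1 = d}`"; **Definition 2.1** "`L̊²_n = {f ∈ P²_n |
  𝓗_f is nonsingular and has exactly one positive eigenvalue}` […] `L̊^d_n = {f ∈ P^d_n | ∂_i f ∈ L̊^{d-1}_n for
  all i}` […] The polynomials in `L̊^d_n` are called *strictly Lorentzian*, and the limits of strictly Lorentzian
  polynomials are called *Lorentzian*."; after Lemma 2.5 (p. 9): "a quadratic form with nonnegative coefficients is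
  Lorentzian if and only if it is stable."
* §2.2 (p. 11): "we define a subset `J ⊆ ℕ^n` to be M-convex if […] For any `α, β ∈ J` and any index `i` satisfying
  `α_i > β_i`, there is an index `j` satisfying `α_j < β_j` and `α - e_i + e_j ∈ J`." (the *exchange property*);
  "We write `f` in the normalized form `f = Σ_{α ∈ ℕ^n} (c_α/α!) w^α`, where `α! = Π_i α_i!`. The *support* of the
  polynomial `f` is […] `supp(f) = {α ∈ ℕ^n | c_α ≠ 0}`. We write `M^d_n` for the set of all degree `d` homogeneous
  polynomials in `ℝ_{≥0}[w_1, …, w_n]` whose supports are M-convex. […] the zero polynomial belongs to `M^d_n`, and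
  `f ∈ M^d_n` implies `∂_i f ∈ M^{d-1}_n`." **Definition 2.6.** "We set `L^0_n = S^0_n`, `L^1_n = S^1_n`, and
  `L²_n = S²_n`. For `d` larger than `2`, we define
  `L^d_n = {f ∈ M^d_n | ∂_i f ∈ L^{d-1}_n for all i ∈ [n]} = {f ∈ M^d_n | ∂^α f ∈ L²_n for every α ∈ Δ^{d-2}_n}`."
  (`S^d_n` = "degree `d` homogeneous stable polynomials in `n` variables with nonnegative coefficients".)
* §2.4 **Theorem 2.25** (p. 24): "The closure of `L̊^d_n` in `H^d_n` is `L^d_n`. […] Therefore, a degree `d`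
  homogeneous polynomial `f` with nonnegative coefficients is Lorentzian if and only if the support of `f` is
  M-convex and `∂^α f` has at most one positive eigenvalue for every `α ∈ Δ^{d-2}_n`. In other words, Definitions
  2.1 and 2.6 define the same class of polynomials."
* §4.1 **Proposition 4.4** (p. 47): "If `f = Σ_{α ∈ Δ^d_n} (c_α/α!) w^α` is a Lorentzian polynomial, then
  `c_α² ≥ c_{α+e_i-e_j} c_{α-e_i+e_j}` for any `i, j ∈ [n]` and any `α ∈ Δ^d_n`." Proof: "Consider the Lorentzian
  polynomial `∂^{α-e_i-e_j} f`. Substituting `w_k` by zero for all `k` other than `i` and `j`, we get the bivariate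
  quadratic polynomial `½ c_{α+e_i-e_j} w_i² + c_α w_i w_j + ½ c_{α-e_i+e_j} w_j²` […] hence
  `c_α² ≥ c_{α+e_i-e_j} c_{α-e_i+e_j}`."; proofs of Thm. 4.1 / Thm. 4.6 (pp. 47, 49): "every coefficient of `vol`
  is positive. Thus, by Theorem 2.25, it is enough to show that `∂^α vol` [has at most one positive eigenvalue]
  for every `α ∈ Δ^{d-2}_n`" (the full simplex `Δ^d_n` being M-convex).
* Y. Shenfeld, R. van Handel, Proc. AMS 147 (2019) [ShenfeldVanHandel2019], Lemma 2.9: for a symmetric matrix,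
  "The positive eigenspace of `A` has dimension at most one" ⇔ "`⟨x,Ay⟩² ≥ ⟨x,Ax⟩⟨y,Ay⟩` for all `x, y` such that
  `⟨y,Ay⟩ ≥ 0`" — the reading `sigPos ≤ 1` of "at most one positive eigenvalue" (tree: `mul_le_sq_of_sigPos_le_one`).

## What is here (variables indexed by a finite type `σ` — Brändén–Huh's `[n]`; coefficients in `ℝ`)

* §1 `IsMConvex J` (the exchange property) — `isMConvex_empty`, **`isMConvex_setOf_degree_eq`** (`Δ^d_n` is
  M-convex), `isMConvex_of_subset_degree_le_one` (every `J ⊆ Δ^0_n` or `Δ^1_n`), degree bookkeeping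
  (`degree_sub_single_add_one`, `eq_single_of_degree_eq_one`).
* §2 `normCoeff α f = α! · coeff α f` (the `c_α` of the normalized form) — `normCoeff_pderiv`
  (`c_β(∂_i f) = c_{β+e_i}(f)`: differentiation SHIFTS normalized coefficients).
* §3 `iterPderiv α f = ∂^α f` (on monomials `∂^α w^γ = (Π_j γ_j!/(γ_j-α_j)!) w^{γ-α}`), identified with the iterate of
  Mathlib's `MvPolynomial.pderiv` by `iterPderiv_zero`, **`iterPderiv_add_single`** (`∂^{α+e_i} = ∂_i ∂^α`),
  `iterPderiv_single`; `coeff_iterPderiv`, **`normCoeff_iterPderiv`** (`c_β(∂^α f) = c_{α+β}(f)`), homogeneity.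
* §4 `hessian q = (∂_i ∂_j q |_{w=0})_{i,j}` — `hessian_apply_eq_normCoeff` (`= c_{e_i+e_j}(q)`), symmetry,
  **`hessian_iterPderiv`** (`𝓗(∂^α f)_{ij} = c_{α+e_i+e_j}(f)`).
* §5 **`lorentzian σ d`** = `L^d_n` BY DEFINITION 2.6 (recursive in `d` through `∂_i`; `L^0, L^1` = nonnegative
  coefficients; `L²` = nonnegative quadratics with M-convex support whose Hessian has at most one positive
  eigenvalue, i.e. Theorem 2.25 read at `d = 2`), unfolding lemmas, the `M^d_n` conditions
  (`isHomogeneous_of_mem_lorentzian`, `coeff_nonneg_of_mem_lorentzian`, `isMConvex_support_of_mem_lorentzian`),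
  `pderiv_mem_lorentzian` (`∂_i L^{d+1}_n ⊆ L^d_n`), **`iterPderiv_mem_lorentzian`** (`f ∈ L^{d+|α|}_n ⇒ ∂^α f ∈ L^d_n`),
  `zero_mem_lorentzian`.
* §6 **`mem_lorentzian_of_forall_coeff_pos`** — Theorem 2.25 in the FULL-SUPPORT case used by Thms. 4.1 / 4.6:
  a degree-`d` form all of whose degree-`d` coefficients are positive and all of whose matrices
  `(c_{α+e_i+e_j})_{i,j}`, `α ∈ Δ^{d-2}`, have at most one positive eigenvalue is Lorentzian;
  **`normCoeff_sq_ge`** — Proposition 4.4 (`c_{α-e_i+e_j} c_{α-e_j+e_i} ≤ c_α²`).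
* §7 `IsMConvex.shift`, `isMConvex_support_pderiv` ("`f ∈ M^d_n` implies `∂_i f ∈ M^{d-1}_n`"),
  **`mem_lorentzian_iff_forall_iterPderiv`** — the second equality of Def. 2.6:
  `L^d_n = {f ∈ M^d_n | ∂^α f ∈ L²_n for every α ∈ Δ^{d-2}_n}`.

Definitions carry bodies; theorems only otherwise; no `sorry`, no named fact (net debt 0). The CLOSURE definition
(Def. 2.1: limits of strictly Lorentzian polynomials) and its equivalence with Def. 2.6 (the content of Thm. 2.25:
Thm. 2.10, the `c`-Rayleigh property, Thm. 2.23) are NOT formalized here — `lorentzian` is Def. 2.6.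

## References

* [BrandenHuh2019] P. Brändén, J. Huh, *Lorentzian polynomials*, Ann. of Math. (2) 192 (2020) 821–891,
  arXiv:1902.03719 — §2.1 Def. 2.1, Lemma 2.5; §2.2 (M-convex sets, normalized form), Def. 2.6; §2.4 Thm. 2.25;
  §4.1 Prop. 4.4; §4.2 Thm. 4.6.
* [ShenfeldVanHandel2019] Y. Shenfeld, R. van Handel, *Mixed volumes and the Bochner method*, Proc. AMS 147 (2019),
  Lemma 2.9.
-/

noncomputable section

open MvPolynomial Finsupp
open scoped Nat

namespace Literature.Combinatorics.LorentzianPolynomials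

variable {σ : Type*}

/-! ## §1 M-convex subsets of `ℕ^n` (the exchange property) -/

section MConvex

/-- A subset `J ⊆ ℕ^σ` is **M-convex** if it has the *exchange property*: "For any `α, β ∈ J` and any index `i`
satisfying `α_i > β_i`, there is an index `j` satisfying `α_j < β_j` and `α - e_i + e_j ∈ J`" (Murota's M-convex
sets; `e_i = Finsupp.single i 1`, and `α - e_i` is the truncated subtraction of `ℕ^σ`, exact here since
`α_i ≥ 1`). [cite: BrandenHuh2019, §2.2 (p. 11, exchange property for M-convex sets)] -/
def IsMConvex (J : Set (σ →₀ ℕ)) : Prop :=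
  ∀ ⦃α β : σ →₀ ℕ⦄, α ∈ J → β ∈ J → ∀ i, β i < α i →
    ∃ j, α j < β j ∧ α - single i 1 + single j 1 ∈ J

/-- "in our convention, the empty subset of `ℕ^n` is an M-convex set." [cite: BrandenHuh2019, §2.2 (p. 11)] -/
theorem isMConvex_empty : IsMConvex (∅ : Set (σ →₀ ℕ)) :=
  fun _ _ h ↦ (Set.notMem_empty _ h).elim

/-- `|α - e_i| = |α| - 1` when `α_i ≠ 0`. [cite: BrandenHuh2019, §2.1 (p. 8, `|α|_1`)] -/
theorem degree_sub_single_add_one {α : σ →₀ ℕ} {i : σ} (h : α i ≠ 0) :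
    (α - single i 1).degree + 1 = α.degree := by
  conv_rhs => rw [← sub_add_single_one_cancel h]
  rw [map_add, degree_single]

/-- `|α - e_i + e_j| = |α|` when `α_i ≠ 0`. [cite: BrandenHuh2019, §2.2 (p. 11: "any M-convex subset of `ℕ^n` is
necessarily contained in the discrete simplex `Δ^d_n` for some `d`")] -/
theorem degree_sub_single_add_single {α : σ →₀ ℕ} {i : σ} (h : α i ≠ 0) (j : σ) :
    (α - single i 1 + single j 1).degree = α.degree := by
  rw [map_add, degree_single, degree_sub_single_add_one h]

/-- If `β ≤ α` pointwise and `β_i < α_i` then `|β| < |α|`. [cite: BrandenHuh2019, §2.1 (p. 8)] -/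
theorem degree_lt_degree_of_le_of_lt {α β : σ →₀ ℕ} (hle : β ≤ α) {i : σ} (hi : β i < α i) :
    β.degree < α.degree := by
  obtain ⟨γ, rfl⟩ := exists_add_of_le hle
  rw [map_add]
  have hγ : γ i ≠ 0 := by
    intro h0
    rw [Finsupp.add_apply, h0, add_zero] at hi
    exact lt_irrefl _ hi
  have : 0 < γ.degree := by
    rw [← degree_sub_single_add_one hγ]
    exact Nat.succ_pos _
  omega

/-- **The discrete simplex `Δ^d_n = {α : |α| = d}` is M-convex** (so is, therefore, the support of any degree-`d`
form all of whose coefficients are nonzero — the case of the volume polynomials in the proofs of Thms. 4.1 and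
4.6: "every coefficient of `vol` is positive. Thus, by Theorem 2.25, it is enough to show that `∂^α vol` is
Lorentzian"). [cite: BrandenHuh2019, §2.2 (p. 11) and §4.1 proof of Thm. 4.1 (p. 47)] -/
theorem isMConvex_setOf_degree_eq (d : ℕ) : IsMConvex {α : σ →₀ ℕ | α.degree = d} := by
  intro α β hα hβ i hi
  simp only [Set.mem_setOf_eq] at hα hβ ⊢
  -- there is an index `j` with `α_j < β_j`, since `|α| = |β|` and `α_i > β_i`
  have hex : ∃ j, α j < β j := by
    by_contra h
    push Not at h
    have hlt := degree_lt_degree_of_le_of_lt (α := α) (β := β) (fun k ↦ h k) hi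
    omega
  obtain ⟨j, hj⟩ := hex
  refine ⟨j, hj, ?_⟩
  rw [degree_sub_single_add_single (by omega) j, hα]

/-- A degree-`1` exponent with `α_i ≠ 0` is `e_i`. [cite: BrandenHuh2019, §2.1 (p. 8, `Δ^d_n`)] -/
theorem eq_single_of_degree_eq_one {α : σ →₀ ℕ} (hα : α.degree = 1) {i : σ} (hi : α i ≠ 0) :
    α = Finsupp.single i 1 := by
  have h := degree_sub_single_add_one hi
  rw [hα] at h
  have h0 : (α - Finsupp.single i 1).degree = 0 := by omega
  rw [Finsupp.degree_eq_zero_iff] at h0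
  rw [← sub_add_single_one_cancel hi, h0, zero_add]

/-- `α - e_i = α` when `α_i = 0` (truncated subtraction). [folklore] -/
private theorem sub_single_eq_self_of_apply_eq_zero {α : σ →₀ ℕ} {i : σ} (h : α i = 0) :
    α - Finsupp.single i 1 = α := by
  ext k
  rw [Finsupp.tsub_apply]
  by_cases hk : k = i
  · subst hk; rw [h, Finsupp.single_eq_same]
  · rw [Finsupp.single_eq_of_ne hk, tsub_zero]

/-- Every subset of `Δ^0_n` or `Δ^1_n` is M-convex (so `S^0_n ⊆ M^0_n`, `S^1_n ⊆ M^1_n` need no support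
condition). [cite: BrandenHuh2019, §2.2 (p. 11, "`S^d_n ⊆ M^d_n`")] -/
theorem isMConvex_of_subset_degree_le_one {J : Set (σ →₀ ℕ)} {d : ℕ} (hd : d ≤ 1)
    (hJ : J ⊆ {α | α.degree = d}) : IsMConvex J := by
  intro α β hα hβ i hi
  have hαd : α.degree = d := hJ hα
  have hβd : β.degree = d := hJ hβ
  have hαi : α i ≠ 0 := by omega
  have h1 := degree_sub_single_add_one hαi
  have hd1 : d = 1 := by omega
  subst hd1
  have hαe : α = Finsupp.single i 1 := eq_single_of_degree_eq_one hαd hαi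
  -- `β = e_j` for some `j ≠ i`
  have hβ0 : β ≠ 0 := by
    intro h0; rw [h0, map_zero] at hβd; exact zero_ne_one hβd
  obtain ⟨j, hj⟩ := Finsupp.ne_iff.1 hβ0
  have hβj : β j ≠ 0 := by simpa using hj
  have hβe : β = Finsupp.single j 1 := eq_single_of_degree_eq_one hβd hβj
  have hji : j ≠ i := by
    rintro rfl
    rw [hαe, hβe] at hi
    exact lt_irrefl _ hi
  refine ⟨j, ?_, ?_⟩
  · rw [hαe, hβe, Finsupp.single_eq_same, Finsupp.single_eq_of_ne hji]
    exact Nat.zero_lt_one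
  · rw [hαe, tsub_self, zero_add, ← hβe]
    exact hβ

end MConvex

/-! ## §2 Normalized coefficients `c_α = α! · coeff_α f` -/

section NormCoeff

variable [Fintype σ]

/-- `α! = Π_i α_i!`, as a real number. [cite: BrandenHuh2019, §2.2 (p. 11, "`α! = Π_{i=1}^n α_i!`")] -/
def factorialProd (α : σ →₀ ℕ) : ℝ := ∏ i, ((α i)! : ℝ)

/-- `α! > 0`. [cite: BrandenHuh2019, §2.2 (p. 11)] -/
theorem factorialProd_pos (α : σ →₀ ℕ) : 0 < factorialProd α :=
  Finset.prod_pos fun i _ ↦ by exact_mod_cast Nat.factorial_pos (α i)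

/-- `α! ≠ 0`. [cite: BrandenHuh2019, §2.2 (p. 11)] -/
theorem factorialProd_ne_zero (α : σ →₀ ℕ) : factorialProd α ≠ 0 := (factorialProd_pos α).ne'

/-- `0! = 1`. [cite: BrandenHuh2019, §2.2 (p. 11)] -/
@[simp] theorem factorialProd_zero : factorialProd (0 : σ →₀ ℕ) = 1 := by
  simp [factorialProd]

/-- `(β + e_i)! = β! · (β_i + 1)`. [cite: BrandenHuh2019, §2.2 (p. 11)] -/
theorem factorialProd_add_single (β : σ →₀ ℕ) (i : σ) :
    factorialProd (β + Finsupp.single i 1) = factorialProd β * (β i + 1) := by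
  classical
  unfold factorialProd
  have h : ∀ j, (((β + Finsupp.single i 1 : σ →₀ ℕ) j)! : ℝ) =
      ((β j)! : ℝ) * (if j = i then (β i : ℝ) + 1 else 1) := by
    intro j
    by_cases hj : j = i
    · subst hj
      rw [if_pos rfl, Finsupp.add_apply, Finsupp.single_eq_same, Nat.factorial_succ]
      push_cast
      ring
    · rw [if_neg hj, Finsupp.add_apply, Finsupp.single_eq_of_ne hj, add_zero, mul_one]
  simp_rw [h, Finset.prod_mul_distrib, Finset.prod_ite_eq' Finset.univ i, if_pos (Finset.mem_univ i)]

/-- The **normalized coefficient** `c_α(f) = α! · coeff_α f`, so that `f = Σ_α (c_α/α!) w^α` ("We write `f` in the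
normalized form `f = Σ (c_α/α!) w^α`"). [cite: BrandenHuh2019, §2.2 (p. 11)] -/
def normCoeff (α : σ →₀ ℕ) (f : MvPolynomial σ ℝ) : ℝ := factorialProd α * coeff α f

/-- `c_α(f) = α! · coeff_α f`. [cite: BrandenHuh2019, §2.2 (p. 11)] -/
theorem normCoeff_def (α : σ →₀ ℕ) (f : MvPolynomial σ ℝ) : normCoeff α f = factorialProd α * coeff α f := rfl

/-- `c_α(0) = 0`. [cite: BrandenHuh2019, §2.2 (p. 11)] -/
@[simp] theorem normCoeff_zero_right (α : σ →₀ ℕ) : normCoeff α (0 : MvPolynomial σ ℝ) = 0 := by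
  simp [normCoeff]

/-- `c_α` is additive. [cite: BrandenHuh2019, §2.2 (p. 11)] -/
theorem normCoeff_add (α : σ →₀ ℕ) (f g : MvPolynomial σ ℝ) :
    normCoeff α (f + g) = normCoeff α f + normCoeff α g := by
  simp [normCoeff, mul_add]

/-- `c_α` is homogeneous. [cite: BrandenHuh2019, §2.2 (p. 11)] -/
theorem normCoeff_smul (α : σ →₀ ℕ) (c : ℝ) (f : MvPolynomial σ ℝ) :
    normCoeff α (c • f) = c * normCoeff α f := by
  simp [normCoeff, mul_left_comm]

/-- `c_α = 0 ↔ coeff_α = 0` (so `supp f = {α | c_α ≠ 0} = {α | coeff_α f ≠ 0}`). [cite: BrandenHuh2019, §2.2 (p. 11)] -/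
theorem normCoeff_eq_zero_iff {α : σ →₀ ℕ} {f : MvPolynomial σ ℝ} : normCoeff α f = 0 ↔ coeff α f = 0 := by
  rw [normCoeff, mul_eq_zero, or_iff_right (factorialProd_ne_zero α)]

/-- `c_α ≥ 0 ↔ coeff_α ≥ 0` (`ℝ_{≥0}[w]` in either normalization). [cite: BrandenHuh2019, §2.2 (p. 11)] -/
theorem normCoeff_nonneg_iff {α : σ →₀ ℕ} {f : MvPolynomial σ ℝ} : 0 ≤ normCoeff α f ↔ 0 ≤ coeff α f :=
  mul_nonneg_iff_of_pos_left (factorialProd_pos α)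

/-- `c_α > 0 ↔ coeff_α > 0` (`P^d_n` in either normalization). [cite: BrandenHuh2019, §2.1 (p. 8)] -/
theorem normCoeff_pos_iff {α : σ →₀ ℕ} {f : MvPolynomial σ ℝ} : 0 < normCoeff α f ↔ 0 < coeff α f :=
  mul_pos_iff_of_pos_left (factorialProd_pos α)

/-- A homogeneous polynomial of degree `d` has `c_α = 0` off `Δ^d`. [cite: BrandenHuh2019, §2.1 (p. 8)] -/
theorem normCoeff_eq_zero_of_degree_ne {f : MvPolynomial σ ℝ} {d : ℕ} (hf : f.IsHomogeneous d) {α : σ →₀ ℕ}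
    (hα : α.degree ≠ d) : normCoeff α f = 0 :=
  normCoeff_eq_zero_iff.2 (hf.coeff_eq_zero hα)

/-- **Differentiation shifts normalized coefficients: `c_β(∂_i f) = c_{β+e_i}(f)`** (from Mathlib's
`coeff_β(∂_i f) = (β_i + 1) coeff_{β+e_i} f`). [cite: BrandenHuh2019, §2.2 (p. 11, normalized form) and §2.1
(`∂_i`)] -/
theorem normCoeff_pderiv (β : σ →₀ ℕ) (i : σ) (f : MvPolynomial σ ℝ) :
    normCoeff β (pderiv i f) = normCoeff (β + Finsupp.single i 1) f := by
  rw [normCoeff, normCoeff, coeff_pderiv, factorialProd_add_single]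
  ring

end NormCoeff

/-! ## §3 The iterated partial derivatives `∂^α` -/

section IterPderiv

variable [Fintype σ]

/-- The falling-factorial factor `Π_j γ_j (γ_j - 1) ⋯ (γ_j - α_j + 1) = Π_j γ_j!/(γ_j - α_j)!` of `∂^α w^γ`
(zero unless `α ≤ γ`). [cite: BrandenHuh2019, §2.1 (p. 8, `∂^α = ∂_1^{α_1} ⋯ ∂_n^{α_n}`)] -/
def descFactorialProd (γ α : σ →₀ ℕ) : ℝ := ∏ j, ((γ j).descFactorial (α j) : ℝ)

/-- The falling-factorial factor of `∂^α w^γ` vanishes unless `α ≤ γ` (`∂^α w^γ = 0`). [cite: BrandenHuh2019, §2.1 (p. 8)] -/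
theorem descFactorialProd_eq_zero_of_not_le {γ α : σ →₀ ℕ} (h : ¬ α ≤ γ) : descFactorialProd γ α = 0 := by
  classical
  obtain ⟨j, hj⟩ : ∃ j, γ j < α j := by
    by_contra h'
    push Not at h'
    exact h fun j ↦ h' j
  exact Finset.prod_eq_zero (Finset.mem_univ j) (by exact_mod_cast (Nat.descFactorial_eq_zero_iff_lt.2 hj))

/-- `∂^0 w^γ = w^γ`: the factor is `1`. [cite: BrandenHuh2019, §2.1 (p. 8)] -/
@[simp] theorem descFactorialProd_zero_right (γ : σ →₀ ℕ) : descFactorialProd γ 0 = 1 := by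
  simp [descFactorialProd]

/-- `β! · Π_j (α_j+β_j)!/β_j! = (α+β)!`. [cite: BrandenHuh2019, §2.2 (p. 11)] -/
theorem factorialProd_mul_descFactorialProd_add (α β : σ →₀ ℕ) :
    factorialProd β * descFactorialProd (α + β) α = factorialProd (α + β) := by
  unfold factorialProd descFactorialProd
  rw [← Finset.prod_mul_distrib]
  refine Finset.prod_congr rfl fun j _ ↦ ?_
  rw [Finsupp.add_apply]
  have h := Nat.factorial_mul_descFactorial (Nat.le_add_right (α j) (β j))
  rw [Nat.add_sub_cancel_left] at h
  exact_mod_cast h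

/-- **`∂^α f`**, the iterated partial derivative `∂_1^{α_1} ⋯ ∂_n^{α_n} f`, defined by its action on monomials
`∂^α (c w^γ) = c · (Π_j γ_j!/(γ_j-α_j)!) w^{γ-α}` (the factor vanishes unless `α ≤ γ`); `iterPderiv_zero` and
`iterPderiv_add_single` below identify it with the iterate of Mathlib's `MvPolynomial.pderiv` (the `∂_i` commute).
[cite: BrandenHuh2019, §2.1 (p. 8, "`∂^α = ∂_1^{α_1} ⋯ ∂_n^{α_n}`")] -/
def iterPderiv (α : σ →₀ ℕ) (f : MvPolynomial σ ℝ) : MvPolynomial σ ℝ :=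
  ∑ γ ∈ f.support, monomial (γ - α) (descFactorialProd γ α * coeff γ f)

/-- **`coeff_β(∂^α f) = (Π_j (α_j+β_j)!/β_j!) · coeff_{α+β} f`.** [cite: BrandenHuh2019, §2.1 (p. 8)] -/
theorem coeff_iterPderiv (α β : σ →₀ ℕ) (f : MvPolynomial σ ℝ) :
    coeff β (iterPderiv α f) = descFactorialProd (α + β) α * coeff (α + β) f := by
  classical
  rw [iterPderiv, coeff_sum]
  simp_rw [coeff_monomial]
  rw [Finset.sum_eq_single (α + β)]
  · rw [if_pos (add_tsub_cancel_left α β)]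
  · intro γ _ hne
    rw [ite_eq_right_iff]
    intro hγ
    have hle : ¬ α ≤ γ := by
      intro hle
      apply hne
      rw [← hγ, add_tsub_cancel_of_le hle]
    rw [descFactorialProd_eq_zero_of_not_le hle, zero_mul]
  · intro h
    rw [MvPolynomial.notMem_support_iff.1 h, mul_zero, ite_self]

/-- **`c_β(∂^α f) = c_{α+β}(f)`**: `∂^α` shifts the normalized coefficients by `α`. [cite: BrandenHuh2019, §2.2 (p. 11)] -/
theorem normCoeff_iterPderiv (α β : σ →₀ ℕ) (f : MvPolynomial σ ℝ) :
    normCoeff β (iterPderiv α f) = normCoeff (α + β) f := by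
  rw [normCoeff, normCoeff, coeff_iterPderiv, ← mul_assoc, factorialProd_mul_descFactorialProd_add]

/-- `∂^0 f = f`. [cite: BrandenHuh2019, §2.1 (p. 8)] -/
@[simp] theorem iterPderiv_zero (f : MvPolynomial σ ℝ) : iterPderiv 0 f = f := by
  ext β
  rw [coeff_iterPderiv, zero_add, descFactorialProd_zero_right, one_mul]

/-- **`∂^{α+e_i} f = ∂_i (∂^α f)`** — `iterPderiv` IS the iterate of `MvPolynomial.pderiv`.
[cite: BrandenHuh2019, §2.1 (p. 8, "`∂^α = ∂_1^{α_1} ⋯ ∂_n^{α_n}`")] -/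
theorem iterPderiv_add_single (α : σ →₀ ℕ) (i : σ) (f : MvPolynomial σ ℝ) :
    iterPderiv (α + Finsupp.single i 1) f = pderiv i (iterPderiv α f) := by
  classical
  ext β
  rw [coeff_iterPderiv, coeff_pderiv, coeff_iterPderiv, add_right_comm α (Finsupp.single i 1) β, add_assoc α β]
  -- the falling factorials: at `j = i`, `(a+b+1)!/b! = (b+1) · (a+b+1)!/(b+1)!`
  have h : descFactorialProd (α + (β + Finsupp.single i 1)) (α + Finsupp.single i 1) =
      descFactorialProd (α + (β + Finsupp.single i 1)) α * (β i + 1) := by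
    unfold descFactorialProd
    have hj : ∀ j, (((α + (β + Finsupp.single i 1) : σ →₀ ℕ) j).descFactorial
          ((α + Finsupp.single i 1 : σ →₀ ℕ) j) : ℝ) =
        (((α + (β + Finsupp.single i 1) : σ →₀ ℕ) j).descFactorial (α j) : ℝ) *
          (if j = i then (β i : ℝ) + 1 else 1) := by
      intro j
      by_cases hji : j = i
      · subst hji
        rw [if_pos rfl, Finsupp.add_apply, Finsupp.add_apply, Finsupp.add_apply, Finsupp.single_eq_same,
          Nat.descFactorial_succ, show α j + (β j + 1) - α j = β j + 1 by omega]
        push_cast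
        ring
      · rw [if_neg hji, Finsupp.add_apply α (Finsupp.single i 1), Finsupp.single_eq_of_ne hji,
          add_zero, mul_one]
    simp_rw [hj, Finset.prod_mul_distrib, Finset.prod_ite_eq' Finset.univ i, if_pos (Finset.mem_univ i)]
  rw [h]
  ring

/-- `∂^{e_i} = ∂_i`. [cite: BrandenHuh2019, §2.1 (p. 8)] -/
theorem iterPderiv_single (i : σ) (f : MvPolynomial σ ℝ) : iterPderiv (Finsupp.single i 1) f = pderiv i f := by
  rw [← zero_add (Finsupp.single i 1), iterPderiv_add_single, iterPderiv_zero]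

/-- `∂^{α+e_i} f = ∂^α (∂_i f)` (the `∂_i` commute). [cite: BrandenHuh2019, §2.1 (p. 8)] -/
theorem iterPderiv_add_single' (α : σ →₀ ℕ) (i : σ) (f : MvPolynomial σ ℝ) :
    iterPderiv (α + Finsupp.single i 1) f = iterPderiv α (pderiv i f) := by
  classical
  ext β
  rw [coeff_iterPderiv, coeff_iterPderiv, coeff_pderiv, add_right_comm α (Finsupp.single i 1) β]
  have h : descFactorialProd (α + β + Finsupp.single i 1) (α + Finsupp.single i 1) =
      descFactorialProd (α + β) α * ((α + β : σ →₀ ℕ) i + 1) := by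
    unfold descFactorialProd
    have hj : ∀ j, (((α + β + Finsupp.single i 1 : σ →₀ ℕ) j).descFactorial
          ((α + Finsupp.single i 1 : σ →₀ ℕ) j) : ℝ) =
        (((α + β : σ →₀ ℕ) j).descFactorial (α j) : ℝ) * (if j = i then ((α + β : σ →₀ ℕ) i : ℝ) + 1 else 1) := by
      intro j
      by_cases hji : j = i
      · subst hji
        rw [if_pos rfl, Finsupp.add_apply (α + β), Finsupp.add_apply α (Finsupp.single j 1),
          Finsupp.single_eq_same, Nat.succ_descFactorial_succ]
        push_cast
        ring
      · rw [if_neg hji, Finsupp.add_apply (α + β), Finsupp.add_apply α (Finsupp.single i 1),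
          Finsupp.single_eq_of_ne hji, add_zero, add_zero, mul_one]
    simp_rw [hj, Finset.prod_mul_distrib, Finset.prod_ite_eq' Finset.univ i, if_pos (Finset.mem_univ i)]
  rw [h]
  push_cast
  ring

/-- `∂^α` is additive. [cite: BrandenHuh2019, §2.1 (p. 8)] -/
theorem iterPderiv_add (α : σ →₀ ℕ) (f g : MvPolynomial σ ℝ) :
    iterPderiv α (f + g) = iterPderiv α f + iterPderiv α g := by
  ext β; simp only [coeff_iterPderiv, coeff_add, mul_add]

/-- `∂^α` commutes with scalars. [cite: BrandenHuh2019, §2.1 (p. 8)] -/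
theorem iterPderiv_smul (α : σ →₀ ℕ) (c : ℝ) (f : MvPolynomial σ ℝ) :
    iterPderiv α (c • f) = c • iterPderiv α f := by
  ext β; simp only [coeff_iterPderiv, coeff_smul, smul_eq_mul, mul_left_comm]

/-- `∂^α 0 = 0`. [cite: BrandenHuh2019, §2.1 (p. 8)] -/
@[simp] theorem iterPderiv_zero_right (α : σ →₀ ℕ) : iterPderiv α (0 : MvPolynomial σ ℝ) = 0 := by
  ext β; simp [coeff_iterPderiv]

/-- `∂^α` lowers the degree of a homogeneous polynomial by `|α|`. [cite: BrandenHuh2019, §2.1 (p. 8)] -/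
theorem IsHomogeneous.iterPderiv {f : MvPolynomial σ ℝ} {d : ℕ} (α : σ →₀ ℕ) (hf : f.IsHomogeneous (d + α.degree)) :
    (iterPderiv α f).IsHomogeneous d := by
  have e : (Finsupp.degree : (σ →₀ ℕ) →+ ℕ) = Finsupp.weight (1 : σ → ℕ) := degree_eq_weight_one
  intro β hβ
  rw [coeff_iterPderiv] at hβ
  have h1 : Finsupp.weight (1 : σ → ℕ) (α + β) = d + α.degree := hf (right_ne_zero_of_mul hβ)
  change Finsupp.weight (1 : σ → ℕ) β = d
  rw [← e] at h1 ⊢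
  rw [map_add] at h1
  omega

end IterPderiv

/-! ## §4 The Hessian of a quadratic form -/

section Hessian

/-- **The Hessian** `𝓗_q = (∂_i ∂_j q)_{i,j}` of a polynomial `q`, evaluated at `w = 0` (for a QUADRATIC form `q` the
Hessian is a constant matrix and this is it; in general it records the degree-`2` part: `𝓗_q(0)_{ij} = c_{e_i+e_j}(q)`,
`hessian_apply_eq_normCoeff`). Compare the tree's `Motives/QuadraticFormHessian.hessian` (quadrics over a field,
`Fin (N+1)` variables) and `HodgeTheory/CompleteIntersectionCycleIdeal.hessianMatrix` (polynomial entries), neither of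
which is imported here. [cite: BrandenHuh2019, §2.1 (p. 8, "The *Hessian* of `f` […] `𝓗_f(w) = (∂_i ∂_j f)`")] -/
def hessian (q : MvPolynomial σ ℝ) : Matrix σ σ ℝ := Matrix.of fun i j ↦ coeff 0 (pderiv i (pderiv j q))

/-- `𝓗_q(0)_{ij} = (∂_i ∂_j q)(0)`. [cite: BrandenHuh2019, §2.1 (p. 8)] -/
theorem hessian_apply (q : MvPolynomial σ ℝ) (i j : σ) : hessian q i j = coeff 0 (pderiv i (pderiv j q)) := rfl

variable [Fintype σ]

/-- `𝓗_q(0)_{ij} = c_{e_i+e_j}(q)` (`= coeff` of `w_i w_j` for `i ≠ j`, `= 2 · coeff` of `w_i²` for `i = j`).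
[cite: BrandenHuh2019, §2.1 (p. 8) and §2.2 (p. 11, normalized form)] -/
theorem hessian_apply_eq_normCoeff (q : MvPolynomial σ ℝ) (i j : σ) :
    hessian q i j = normCoeff (Finsupp.single i 1 + Finsupp.single j 1) q := by
  have h0 : coeff 0 (pderiv i (pderiv j q)) = normCoeff 0 (pderiv i (pderiv j q)) := by
    rw [normCoeff, factorialProd_zero, one_mul]
  rw [hessian_apply, h0, normCoeff_pderiv, normCoeff_pderiv, zero_add]

/-- The Hessian is symmetric (`∂_i ∂_j = ∂_j ∂_i`). [cite: BrandenHuh2019, §2.1 (p. 8, "the symmetric matrix")] -/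
theorem hessian_comm (q : MvPolynomial σ ℝ) (i j : σ) : hessian q i j = hessian q j i := by
  rw [hessian_apply_eq_normCoeff, hessian_apply_eq_normCoeff, add_comm]

/-- The Hessian is a symmetric matrix. [cite: BrandenHuh2019, §2.1 (p. 8, "the symmetric matrix")] -/
theorem isSymm_hessian (q : MvPolynomial σ ℝ) : (hessian q).IsSymm :=
  Matrix.IsSymm.ext fun i j ↦ hessian_comm q j i

/-- **`𝓗(∂^α f)_{ij} = c_{α+e_i+e_j}(f)`**: the Hessian of `∂^α f` (`α ∈ Δ^{d-2}`, `f ∈ H^d`) is the matrix of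
normalized coefficients `(c_{α+e_i+e_j})_{i,j}` — the matrix behind "`∂^α f` has at most one positive eigenvalue" and
behind Prop. 4.4. [cite: BrandenHuh2019, §2.1 (p. 8), §2.2 (p. 11), §4.1 proof of Prop. 4.4 (p. 47)] -/
theorem hessian_iterPderiv (α : σ →₀ ℕ) (f : MvPolynomial σ ℝ) (i j : σ) :
    hessian (iterPderiv α f) i j = normCoeff (α + Finsupp.single i 1 + Finsupp.single j 1) f := by
  rw [hessian_apply_eq_normCoeff, normCoeff_iterPderiv, add_assoc]

/-- `𝓗(∂^α f) = (c_{α+e_i+e_j}(f))_{i,j}` as matrices. [cite: BrandenHuh2019, §2.1 (p. 8), §2.2 (p. 11)] -/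
theorem hessian_iterPderiv_eq (α : σ →₀ ℕ) (f : MvPolynomial σ ℝ) :
    hessian (iterPderiv α f) = Matrix.of fun i j ↦ normCoeff (α + Finsupp.single i 1 + Finsupp.single j 1) f :=
  Matrix.ext fun i j ↦ hessian_iterPderiv α f i j

variable [DecidableEq σ]

/-- The quadratic form `wᵀ 𝓗 w` of a real matrix, on the basis vectors: `e_iᵀ M e_j = M_{ij}`. [folklore] -/
private theorem toBilin'_single_single (M : Matrix σ σ ℝ) (i j : σ) :
    Matrix.toBilin' M (Pi.single i 1) (Pi.single j 1) = M i j := by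
  rw [Matrix.toBilin'_apply']
  simp

/-- The bilinear form `(v, w) ↦ vᵀ M w` of a symmetric real matrix is symmetric. [folklore] -/
private theorem isSymm_toBilin'_of_isSymm {M : Matrix σ σ ℝ} (hM : M.IsSymm) : LinearMap.IsSymm (Matrix.toBilin' M) :=
  ⟨fun v w ↦ by
    rw [Matrix.toBilin'_apply', Matrix.toBilin'_apply', Matrix.dotProduct_mulVec, ← Matrix.mulVec_transpose, hM.eq,
      dotProduct_comm, RingHom.id_apply]⟩

end Hessian

/-! ## §5 The spaces `L^d_n` of Lorentzian polynomials (Definition 2.6) -/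

section Lorentzian

variable (σ) [Fintype σ] [DecidableEq σ]

/-- **The degree-`d` Lorentzian polynomials `L^d_n ⊆ ℝ[w_i : i ∈ σ]`, Brändén–Huh's DEFINITION 2.6** — by recursion on
the degree: "We set `L^0_n = S^0_n`, `L^1_n = S^1_n`, and `L²_n = S²_n`. For `d` larger than `2`, we define
`L^d_n = {f ∈ M^d_n | ∂_i f ∈ L^{d-1}_n for all i ∈ [n]}`", where `M^d_n` = "degree `d` homogeneous polynomials in
`ℝ_{≥0}[w_1, …, w_n]` whose supports are M-convex" and `S^d_n` = degree-`d` homogeneous stable polynomials with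
nonnegative coefficients, which for `d ≤ 1` is every degree-`d` form with nonnegative coefficients and for `d = 2` is
("a quadratic form with nonnegative coefficients is Lorentzian if and only if it is stable", Lemma 2.5; Theorem 2.25
at `d = 2`) the set of quadratic forms with nonnegative coefficients, M-convex support, and Hessian with AT MOST ONE
POSITIVE EIGENVALUE — read, as everywhere in the lane, as `sigPos ≤ 1` for Mathlib's positive index of inertia of the
quadratic form `w ↦ wᵀ 𝓗_f w` (Shenfeld–van Handel Lemma 2.9 (3): "The positive eigenspace of `A` has dimension at
most one"). By Theorem 2.25 this is the class of LORENTZIAN polynomials (the closure of the strictly Lorentzian ones,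
Def. 2.1), which is not re-proved here. [cite: BrandenHuh2019, §2.2 Definition 2.6 (pp. 11–12); §2.1 Def. 2.1 and
Lemma 2.5 (pp. 8–9); §2.4 Thm. 2.25 (p. 24)] [cite: ShenfeldVanHandel2019, Lemma 2.9] -/
def lorentzian : ℕ → Set (MvPolynomial σ ℝ)
  | 0 => {f | f.IsHomogeneous 0 ∧ ∀ α, 0 ≤ coeff α f}
  | 1 => {f | f.IsHomogeneous 1 ∧ ∀ α, 0 ≤ coeff α f}
  | 2 => {f | f.IsHomogeneous 2 ∧ (∀ α, 0 ≤ coeff α f) ∧ IsMConvex {α | coeff α f ≠ 0} ∧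
      sigPos (Matrix.toBilin' (hessian f)).toQuadraticMap ≤ 1}
  | d + 3 => {f | f.IsHomogeneous (d + 3) ∧ (∀ α, 0 ≤ coeff α f) ∧ IsMConvex {α | coeff α f ≠ 0} ∧
      ∀ i, pderiv i f ∈ lorentzian (d + 2)}

variable {σ}

/-- `L^0_n = S^0_n`: the nonnegative constants. [cite: BrandenHuh2019, §2.2 Def. 2.6 (p. 11)] -/
theorem mem_lorentzian_zero {f : MvPolynomial σ ℝ} :
    f ∈ lorentzian σ 0 ↔ f.IsHomogeneous 0 ∧ ∀ α, 0 ≤ coeff α f := Iff.rfl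

/-- `L^1_n = S^1_n`: the linear forms with nonnegative coefficients. [cite: BrandenHuh2019, §2.2 Def. 2.6 (p. 11)] -/
theorem mem_lorentzian_one {f : MvPolynomial σ ℝ} :
    f ∈ lorentzian σ 1 ↔ f.IsHomogeneous 1 ∧ ∀ α, 0 ≤ coeff α f := Iff.rfl

/-- `L²_n`: "a quadratic form with nonnegative coefficients is Lorentzian if and only if […] the support of `f` is
M-convex and [`𝓗_f`] has at most one positive eigenvalue". [cite: BrandenHuh2019, §2.1 Lemma 2.5 (p. 9), §2.4
Thm. 2.25 (p. 24)] -/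
theorem mem_lorentzian_two {f : MvPolynomial σ ℝ} :
    f ∈ lorentzian σ 2 ↔ f.IsHomogeneous 2 ∧ (∀ α, 0 ≤ coeff α f) ∧ IsMConvex {α | coeff α f ≠ 0} ∧
      sigPos (Matrix.toBilin' (hessian f)).toQuadraticMap ≤ 1 := Iff.rfl

/-- `L^d_n = {f ∈ M^d_n | ∂_i f ∈ L^{d-1}_n for all i}` for `d ≥ 3`. [cite: BrandenHuh2019, §2.2 Def. 2.6 (p. 12)] -/
theorem mem_lorentzian_add_three {d : ℕ} {f : MvPolynomial σ ℝ} :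
    f ∈ lorentzian σ (d + 3) ↔ f.IsHomogeneous (d + 3) ∧ (∀ α, 0 ≤ coeff α f) ∧ IsMConvex {α | coeff α f ≠ 0} ∧
      ∀ i, pderiv i f ∈ lorentzian σ (d + 2) := Iff.rfl

/-- `L^d_n ⊆ H^d_n`. [cite: BrandenHuh2019, §2.2 Def. 2.6 (p. 12)] -/
theorem isHomogeneous_of_mem_lorentzian : ∀ {d : ℕ} {f : MvPolynomial σ ℝ}, f ∈ lorentzian σ d → f.IsHomogeneous d
  | 0, _, h => h.1
  | 1, _, h => h.1
  | 2, _, h => h.1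
  | _ + 3, _, h => h.1

/-- `L^d_n ⊆ ℝ_{≥0}[w]`. [cite: BrandenHuh2019, §2.2 Def. 2.6 (p. 12)] -/
theorem coeff_nonneg_of_mem_lorentzian : ∀ {d : ℕ} {f : MvPolynomial σ ℝ}, f ∈ lorentzian σ d →
    ∀ α, 0 ≤ coeff α f
  | 0, _, h => h.2
  | 1, _, h => h.2
  | 2, _, h => h.2.1
  | _ + 3, _, h => h.2.1

/-- The normalized coefficients of a polynomial in `L^d_n` are nonnegative. [cite: BrandenHuh2019, §2.2 Def. 2.6 (p. 12)] -/
theorem normCoeff_nonneg_of_mem_lorentzian {d : ℕ} {f : MvPolynomial σ ℝ} (hf : f ∈ lorentzian σ d) (α : σ →₀ ℕ) :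
    0 ≤ normCoeff α f :=
  normCoeff_nonneg_iff.2 (coeff_nonneg_of_mem_lorentzian hf α)

/-- `L^d_n ⊆ M^d_n`: the support of a polynomial in `L^d_n` is M-convex. [cite: BrandenHuh2019, §2.2 Def. 2.6 (p. 12)] -/
theorem isMConvex_support_of_mem_lorentzian : ∀ {d : ℕ} {f : MvPolynomial σ ℝ}, f ∈ lorentzian σ d →
    IsMConvex {α | coeff α f ≠ 0}
  | 0, _, h => isMConvex_of_subset_degree_le_one zero_le_one fun _ hα ↦ by
      by_contra hd; exact hα (h.1.coeff_eq_zero hd)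
  | 1, _, h => isMConvex_of_subset_degree_le_one le_rfl fun _ hα ↦ by
      by_contra hd; exact hα (h.1.coeff_eq_zero hd)
  | 2, _, h => h.2.2.1
  | _ + 3, _, h => h.2.2.1

omit [Fintype σ] [DecidableEq σ] in
/-- `∂_i` preserves nonnegativity of coefficients. [cite: BrandenHuh2019, §2.2 (p. 11, "`f ∈ M^d_n` implies
`∂_i f ∈ M^{d-1}_n`")] -/
theorem coeff_pderiv_nonneg {f : MvPolynomial σ ℝ} (hf : ∀ α, 0 ≤ coeff α f) (i : σ) (β : σ →₀ ℕ) :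
    0 ≤ coeff β (pderiv i f) := by
  rw [coeff_pderiv]
  exact mul_nonneg (hf _) (by positivity)

/-- **`f ∈ L^{d+1}_n ⇒ ∂_i f ∈ L^d_n`** (by definition for `d + 1 ≥ 3`; for `d + 1 ≤ 2` the target conditions are
just homogeneity and nonnegativity). [cite: BrandenHuh2019, §2.2 Def. 2.6 (p. 12)] -/
theorem pderiv_mem_lorentzian : ∀ {d : ℕ} {f : MvPolynomial σ ℝ}, f ∈ lorentzian σ (d + 1) → ∀ i : σ,
    pderiv i f ∈ lorentzian σ d
  | 0, _, h, i => ⟨h.1.pderiv, coeff_pderiv_nonneg h.2 i⟩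
  | 1, _, h, i => ⟨h.1.pderiv, coeff_pderiv_nonneg h.2.1 i⟩
  | _ + 2, _, h, i => h.2.2.2 i

/-- **`f ∈ L^{d+|α|}_n ⇒ ∂^α f ∈ L^d_n`**; in particular (`d = 2`) the inclusion
`L^d_n ⊆ {f ∈ M^d_n | ∂^α f ∈ L²_n for every α ∈ Δ^{d-2}_n}` of Definition 2.6's second description.
[cite: BrandenHuh2019, §2.2 Def. 2.6 (p. 12)] -/
theorem iterPderiv_mem_lorentzian {d : ℕ} :
    ∀ {α : σ →₀ ℕ} {f : MvPolynomial σ ℝ}, f ∈ lorentzian σ (d + α.degree) → iterPderiv α f ∈ lorentzian σ d := by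
  suffices h : ∀ (n : ℕ) {α : σ →₀ ℕ} {f : MvPolynomial σ ℝ}, α.degree = n → f ∈ lorentzian σ (d + n) →
      iterPderiv α f ∈ lorentzian σ d from fun {α} {f} hf ↦ h _ rfl hf
  intro n
  induction n with
  | zero =>
    intro α f hα hf
    rw [Finsupp.degree_eq_zero_iff] at hα
    subst hα
    rwa [iterPderiv_zero]
  | succ n ih =>
    intro α f hα hf
    have hα0 : α ≠ 0 := by
      intro h0; rw [h0, map_zero] at hα; exact Nat.succ_ne_zero n hα.symm
    obtain ⟨i, hi⟩ := Finsupp.ne_iff.1 hα0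
    have hαi : α i ≠ 0 := by simpa using hi
    have hdeg : (α - Finsupp.single i 1).degree = n := by
      have := degree_sub_single_add_one hαi; omega
    rw [← sub_add_single_one_cancel hαi, iterPderiv_add_single']
    exact ih hdeg (pderiv_mem_lorentzian (by rwa [← add_assoc] at hf) i)

/-- `sigPos` of the zero quadratic form is `0`. [folklore] -/
private theorem sigPos_zero {V : Type*} [AddCommGroup V] [Module ℝ V] [FiniteDimensional ℝ V] :
    sigPos (0 : QuadraticForm ℝ V) = 0 := by
  obtain ⟨W, hW, hpos⟩ := exists_finrank_eq_sigPos_and_posDef (0 : QuadraticForm ℝ V)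
  rw [← hW]
  have : W = ⊥ := by
    rw [Submodule.eq_bot_iff]
    intro x hx
    by_contra hx0
    have h := hpos ⟨x, hx⟩ (by simpa using hx0)
    simp at h
  rw [this, finrank_bot]

/-- "the zero polynomial belongs to `M^d_n`" — and to `L^d_n`. [cite: BrandenHuh2019, §2.2 (p. 11)] -/
theorem zero_mem_lorentzian : ∀ d : ℕ, (0 : MvPolynomial σ ℝ) ∈ lorentzian σ d
  | 0 => ⟨isHomogeneous_zero σ ℝ 0, fun _ ↦ by simp⟩
  | 1 => ⟨isHomogeneous_zero σ ℝ 1, fun _ ↦ by simp⟩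
  | 2 => by
    refine ⟨isHomogeneous_zero σ ℝ 2, fun _ ↦ by simp, ?_, ?_⟩
    · convert isMConvex_empty (σ := σ) using 1
      ext α; simp
    · have h0 : hessian (0 : MvPolynomial σ ℝ) = 0 := by
        ext i j; simp [hessian_apply]
      rw [h0, map_zero, LinearMap.BilinMap.toQuadraticMap_zero, sigPos_zero]
      exact zero_le_one
  | d + 3 => by
    refine ⟨isHomogeneous_zero σ ℝ _, fun _ ↦ by simp, ?_, fun i ↦ ?_⟩
    · convert isMConvex_empty (σ := σ) using 1
      ext α; simp
    · rw [map_zero]; exact zero_mem_lorentzian (d + 2)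

end Lorentzian

/-! ## §6 Theorem 2.25 in the full-support case, and Proposition 4.4 -/

section Criterion

variable [Fintype σ] [DecidableEq σ]

omit [Fintype σ] [DecidableEq σ] in
/-- A degree-`d` form whose degree-`d` coefficients are positive has nonnegative coefficients.
[cite: BrandenHuh2019, §2.1 (p. 8, `P^d_n`)] -/
theorem coeff_nonneg_of_forall_coeff_pos {d : ℕ} {f : MvPolynomial σ ℝ} (hf : f.IsHomogeneous d)
    (hpos : ∀ α : σ →₀ ℕ, α.degree = d → 0 < coeff α f) (α : σ →₀ ℕ) : 0 ≤ coeff α f := by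
  by_cases hα : α.degree = d
  · exact (hpos α hα).le
  · rw [hf.coeff_eq_zero hα]

omit [Fintype σ] [DecidableEq σ] in
/-- A degree-`d` form whose degree-`d` coefficients are positive has support `Δ^d_n` ("every coefficient of `vol` is
positive"). [cite: BrandenHuh2019, §4.1 proof of Thm. 4.1 (p. 47), §4.2 proof of Thm. 4.6 (p. 49)] -/
theorem support_eq_of_forall_coeff_pos {d : ℕ} {f : MvPolynomial σ ℝ} (hf : f.IsHomogeneous d)
    (hpos : ∀ α : σ →₀ ℕ, α.degree = d → 0 < coeff α f) : {α | coeff α f ≠ 0} = {α : σ →₀ ℕ | α.degree = d} := by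
  ext α
  simp only [Set.mem_setOf_eq]
  refine ⟨fun h ↦ ?_, fun h ↦ (hpos α h).ne'⟩
  by_contra hα
  exact h (hf.coeff_eq_zero hα)

omit [Fintype σ] [DecidableEq σ] in
/-- `∂_i` of a form with positive top-degree coefficients has positive top-degree coefficients.
[cite: BrandenHuh2019, §2.1 (p. 8, `P^d_n`; Def. 2.1)] -/
theorem coeff_pderiv_pos_of_forall_coeff_pos {d : ℕ} {f : MvPolynomial σ ℝ}
    (hpos : ∀ α : σ →₀ ℕ, α.degree = d + 1 → 0 < coeff α f) (i : σ) (β : σ →₀ ℕ) (hβ : β.degree = d) :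
    0 < coeff β (pderiv i f) := by
  rw [coeff_pderiv]
  refine mul_pos (hpos _ ?_) (by positivity)
  rw [map_add, Finsupp.degree_single, hβ]

/-- **Theorem 2.25, full-support case** (the form in which it is applied to the volume polynomials of convex bodies
and of nef divisors, Thms. 4.1 and 4.6: "every coefficient of `vol` is positive. Thus, by Theorem 2.25, it is enough
to show that `∂^α vol` [has at most one positive eigenvalue] for every `α ∈ Δ^{d-2}_n`"): a homogeneous polynomial
of degree `d` ALL of whose degree-`d` coefficients are positive, and such that for every `α ∈ Δ^{d-2}_n` the Hessian
`(c_{α+e_i+e_j})_{i,j}` of `∂^α f` has at most one positive eigenvalue (`sigPos ≤ 1`), belongs to `L^d_n` — its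
support `Δ^d_n` is M-convex (`isMConvex_setOf_degree_eq`) and the conditions descend along `∂_i`
(`c_β(∂_i f) = c_{β+e_i}(f)`). [cite: BrandenHuh2019, §2.4 Thm. 2.25 (p. 24); §4.1 proof of Thm. 4.1 (p. 47); §4.2
proof of Thm. 4.6 (p. 49)] -/
theorem mem_lorentzian_of_forall_coeff_pos : ∀ (d : ℕ) {f : MvPolynomial σ ℝ}, f.IsHomogeneous d →
    (∀ α : σ →₀ ℕ, α.degree = d → 0 < coeff α f) →
    (∀ α : σ →₀ ℕ, α.degree + 2 = d →
      sigPos (Matrix.toBilin' (Matrix.of fun i j ↦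
        normCoeff (α + Finsupp.single i 1 + Finsupp.single j 1) f)).toQuadraticMap ≤ 1) →
    f ∈ lorentzian σ d
  | 0, _, hf, hpos, _ => ⟨hf, coeff_nonneg_of_forall_coeff_pos hf hpos⟩
  | 1, _, hf, hpos, _ => ⟨hf, coeff_nonneg_of_forall_coeff_pos hf hpos⟩
  | 2, f, hf, hpos, hH => by
    refine ⟨hf, coeff_nonneg_of_forall_coeff_pos hf hpos, ?_, ?_⟩
    · rw [support_eq_of_forall_coeff_pos hf hpos]; exact isMConvex_setOf_degree_eq 2
    · have h := hH 0 (by simp)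
      have hm : hessian f = Matrix.of fun i j ↦ normCoeff (0 + Finsupp.single i 1 + Finsupp.single j 1) f :=
        Matrix.ext fun i j ↦ by rw [Matrix.of_apply, zero_add, hessian_apply_eq_normCoeff]
      rwa [hm]
  | d + 3, f, hf, hpos, hH => by
    refine ⟨hf, coeff_nonneg_of_forall_coeff_pos hf hpos, ?_, fun i ↦ ?_⟩
    · rw [support_eq_of_forall_coeff_pos hf hpos]; exact isMConvex_setOf_degree_eq (d + 3)
    · refine mem_lorentzian_of_forall_coeff_pos (d + 2) hf.pderiv
        (coeff_pderiv_pos_of_forall_coeff_pos hpos i) fun α hα ↦ ?_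
      have hm : (Matrix.of fun a b ↦ normCoeff (α + Finsupp.single a 1 + Finsupp.single b 1) (pderiv i f)) =
          Matrix.of fun a b ↦
            normCoeff (α + Finsupp.single i 1 + Finsupp.single a 1 + Finsupp.single b 1) f :=
        Matrix.ext fun a b ↦ by
          rw [Matrix.of_apply, Matrix.of_apply, normCoeff_pderiv, add_right_comm (α + Finsupp.single a 1),
            add_right_comm α]
      rw [hm]
      exact hH (α + Finsupp.single i 1) (by rw [map_add, Finsupp.degree_single]; omega)

/-- The same criterion with the Hessians phrased through `∂^α`: all degree-`d` coefficients positive and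
`sigPos (wᵀ 𝓗_{∂^α f} w) ≤ 1` for all `α ∈ Δ^{d-2}_n` imply `f ∈ L^d_n`. [cite: BrandenHuh2019, §2.4 Thm. 2.25 (p. 24)] -/
theorem mem_lorentzian_of_forall_coeff_pos' {d : ℕ} {f : MvPolynomial σ ℝ} (hf : f.IsHomogeneous d)
    (hpos : ∀ α : σ →₀ ℕ, α.degree = d → 0 < coeff α f)
    (hH : ∀ α : σ →₀ ℕ, α.degree + 2 = d →
      sigPos (Matrix.toBilin' (hessian (iterPderiv α f))).toQuadraticMap ≤ 1) :
    f ∈ lorentzian σ d :=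
  mem_lorentzian_of_forall_coeff_pos d hf hpos fun α hα ↦ by rw [← hessian_iterPderiv_eq]; exact hH α hα

/-- **Proposition 4.4 (the Alexandrov–Fenchel-type inequalities for the normalized coefficients of a Lorentzian
polynomial)**: "If `f = Σ_{α ∈ Δ^d_n} (c_α/α!) w^α` is a Lorentzian polynomial, then `c_α² ≥ c_{α+e_i-e_j}
c_{α-e_i+e_j}` for any `i, j ∈ [n]` and any `α ∈ Δ^d_n`." Here for `f ∈ L^d_n` (Def. 2.6 = Lorentzian by Thm. 2.25),
with `α - e_i` the truncated subtraction of `ℕ^σ` (so that for `α_i = 0` or `α_j = 0` — where Brändén–Huh's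
`c_{α∓e_i±e_j}` refers to an exponent outside `ℕ^n` and is `0` — one factor is the coefficient of an exponent of
degree `d + 1`, i.e. `0`). Proof as printed: the Hessian of the quadratic form `∂^{α-e_i-e_j} f ∈ L²_n` is
`(c_{α-e_i-e_j+e_a+e_b})_{a,b}`; it has at most one positive eigenvalue and nonnegative entries, so the backwards
Schwarz inequality (Shenfeld–van Handel Lemma 2.9 (3) ⇒ (1), tree `mul_le_sq_of_sigPos_le_one`) at `(e_i, e_j)` reads
`c_{α-e_j+e_i} c_{α-e_i+e_j} ≤ c_α²`. [cite: BrandenHuh2019, §4.1 Prop. 4.4 (p. 47)]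
[cite: ShenfeldVanHandel2019, Lemma 2.9 (3) ⇒ (1)] -/
theorem normCoeff_sq_ge {d : ℕ} {f : MvPolynomial σ ℝ} (hf : f ∈ lorentzian σ d) {α : σ →₀ ℕ}
    (hα : α.degree = d) (i j : σ) :
    normCoeff (α - Finsupp.single i 1 + Finsupp.single j 1) f *
        normCoeff (α - Finsupp.single j 1 + Finsupp.single i 1) f ≤ normCoeff α f ^ 2 := by
  have hhom := isHomogeneous_of_mem_lorentzian hf
  -- degenerate cases `α_i = 0` / `α_j = 0`: one factor vanishes by homogeneity
  by_cases hi : α i = 0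
  · rw [sub_single_eq_self_of_apply_eq_zero hi, normCoeff_eq_zero_of_degree_ne hhom
      (by rw [map_add, Finsupp.degree_single, hα]; omega), zero_mul]
    positivity
  by_cases hj : α j = 0
  · rw [sub_single_eq_self_of_apply_eq_zero hj, normCoeff_eq_zero_of_degree_ne hhom
      (α := α + Finsupp.single i 1) (by rw [map_add, Finsupp.degree_single, hα]; omega), mul_zero]
    positivity
  -- `i = j`: equality
  by_cases hij : i = j
  · subst hij
    rw [sub_add_single_one_cancel hi, sq]
  -- main case: `γ = α - e_i - e_j ∈ Δ^{d-2}`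
  set γ : σ →₀ ℕ := α - Finsupp.single i 1 - Finsupp.single j 1 with hγ
  have hγj : (α - Finsupp.single i 1 : σ →₀ ℕ) j ≠ 0 := by
    rwa [Finsupp.tsub_apply, Finsupp.single_eq_of_ne (Ne.symm hij), tsub_zero]
  have hγi : (α - Finsupp.single j 1 : σ →₀ ℕ) i ≠ 0 := by
    rwa [Finsupp.tsub_apply, Finsupp.single_eq_of_ne hij, tsub_zero]
  have h1 : γ + Finsupp.single j 1 = α - Finsupp.single i 1 := by
    rw [hγ, sub_add_single_one_cancel hγj]
  have h2 : γ + Finsupp.single i 1 = α - Finsupp.single j 1 := by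
    rw [hγ, tsub_right_comm, sub_add_single_one_cancel hγi]
  have hγij : γ + Finsupp.single i 1 + Finsupp.single j 1 = α := by
    rw [h2, sub_add_single_one_cancel hj]
  have hγjj : γ + Finsupp.single j 1 + Finsupp.single j 1 = α - Finsupp.single i 1 + Finsupp.single j 1 := by
    rw [h1]
  have hγii : γ + Finsupp.single i 1 + Finsupp.single i 1 = α - Finsupp.single j 1 + Finsupp.single i 1 := by
    rw [h2]
  have hγd : d = 2 + γ.degree := by
    have e1 := degree_sub_single_add_one hi
    have e2 := degree_sub_single_add_one hγj
    rw [hγ]; omega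
  -- `∂^γ f ∈ L²`
  rw [hγd] at hf
  obtain ⟨-, -, -, hsig⟩ := mem_lorentzian_two.1 (iterPderiv_mem_lorentzian hf)
  set B := Matrix.toBilin' (hessian (iterPderiv γ f)) with hB
  have hBs : LinearMap.IsSymm B := isSymm_toBilin'_of_isSymm (isSymm_hessian _)
  have hBij : ∀ a b, B (Pi.single a 1) (Pi.single b 1) =
      normCoeff (γ + Finsupp.single a 1 + Finsupp.single b 1) f := fun a b ↦ by
    rw [hB, toBilin'_single_single, hessian_iterPderiv]
  have hy : 0 ≤ B (Pi.single j 1) (Pi.single j 1) := by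
    rw [hBij]; exact normCoeff_nonneg_of_mem_lorentzian hf _
  have key := Literature.LinearAlgebra.QuadraticForm.mul_le_sq_of_sigPos_le_one B hBs hsig (Pi.single i 1)
    (Pi.single j 1) hy
  rw [hBij, hBij, hBij, hγii, hγjj, hγij] at key
  rwa [mul_comm]

end Criterion

/-! ## §7 `∂_i` preserves M-convexity of the support; the second description of `L^d_n` in Definition 2.6 -/

section SecondDescription

/-- M-convexity is preserved by the shift `J ↦ {β | β + e_i ∈ J}` (the support of `∂_i f` in terms of that of
`f`). [cite: BrandenHuh2019, §2.2 (p. 11, "`f ∈ M^d_n` implies `∂_i f ∈ M^{d-1}_n`")] -/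
theorem IsMConvex.shift {J : Set (σ →₀ ℕ)} (hJ : IsMConvex J) (i : σ) :
    IsMConvex {β : σ →₀ ℕ | β + Finsupp.single i 1 ∈ J} := by
  intro β γ hβ hγ k hk
  simp only [Set.mem_setOf_eq] at hβ hγ ⊢
  have hk' : (γ + Finsupp.single i 1 : σ →₀ ℕ) k < (β + Finsupp.single i 1 : σ →₀ ℕ) k := by
    simpa only [Finsupp.add_apply, add_lt_add_iff_right] using hk
  obtain ⟨j, hj, hmem⟩ := hJ hβ hγ k hk'
  refine ⟨j, by simpa only [Finsupp.add_apply, add_lt_add_iff_right] using hj, ?_⟩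
  have hβk : β k ≠ 0 := by omega
  rwa [← sub_single_one_add hβk, add_right_comm] at hmem

variable [Fintype σ] [DecidableEq σ]

omit [Fintype σ] [DecidableEq σ] in
/-- `supp(∂_i f) = {β | β + e_i ∈ supp(f)}`. [cite: BrandenHuh2019, §2.2 (p. 11)] -/
theorem support_pderiv_eq (f : MvPolynomial σ ℝ) (i : σ) :
    {β | coeff β (pderiv i f) ≠ 0} = {β : σ →₀ ℕ | β + Finsupp.single i 1 ∈ {α | coeff α f ≠ 0}} := by
  ext β
  simp only [Set.mem_setOf_eq, coeff_pderiv, ne_eq, mul_eq_zero, not_or]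
  exact ⟨fun h ↦ h.1, fun h ↦ ⟨h, by positivity⟩⟩

omit [Fintype σ] [DecidableEq σ] in
/-- "`f ∈ M^d_n` implies `∂_i f ∈ M^{d-1}_n`": the support of `∂_i f` is M-convex if that of `f` is.
[cite: BrandenHuh2019, §2.2 (p. 11)] -/
theorem isMConvex_support_pderiv {f : MvPolynomial σ ℝ} (hf : IsMConvex {α | coeff α f ≠ 0}) (i : σ) :
    IsMConvex {β | coeff β (pderiv i f) ≠ 0} := by
  rw [support_pderiv_eq]
  exact hf.shift i

/-- **The second description of `L^d_n` (Definition 2.6):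
`L^d_n = {f ∈ M^d_n | ∂^α f ∈ L²_n for every α ∈ Δ^{d-2}_n}`** (`d = m + 2`).
[cite: BrandenHuh2019, §2.2 Def. 2.6 (p. 12, the second equality)] -/
theorem mem_lorentzian_iff_forall_iterPderiv {m : ℕ} {f : MvPolynomial σ ℝ} :
    f ∈ lorentzian σ (m + 2) ↔
      (f.IsHomogeneous (m + 2) ∧ (∀ α, 0 ≤ coeff α f) ∧ IsMConvex {α | coeff α f ≠ 0}) ∧
        ∀ α : σ →₀ ℕ, α.degree = m → iterPderiv α f ∈ lorentzian σ 2 := by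
  constructor
  · intro hf
    refine ⟨⟨isHomogeneous_of_mem_lorentzian hf, coeff_nonneg_of_mem_lorentzian hf,
      isMConvex_support_of_mem_lorentzian hf⟩, fun α hα ↦ iterPderiv_mem_lorentzian ?_⟩
    rwa [hα, add_comm]
  · induction m generalizing f with
    | zero =>
      rintro ⟨-, h⟩
      simpa only [iterPderiv_zero] using h 0 (map_zero _)
    | succ m ih =>
      rintro ⟨⟨hhom, hnonneg, hM⟩, h⟩
      refine ⟨hhom, hnonneg, hM, fun i ↦ ih ⟨⟨hhom.pderiv, coeff_pderiv_nonneg hnonneg i,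
        isMConvex_support_pderiv hM i⟩, fun α hα ↦ ?_⟩⟩
      rw [← iterPderiv_add_single']
      exact h _ (by rw [map_add, Finsupp.degree_single, hα])

end SecondDescription

end Literature.Combinatorics.LorentzianPolynomials

end
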